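import Summits.HubbardSuperconductivity.HubbardSuperconductivity.Theorems.AnisotropyChordSpinMonotoneCompleteMultipartite
import Summits.HubbardSuperconductivity.HubbardSuperconductivity.Theorems.AnisotropyChordTwoMagnonCoordinates
import Literature.Combinatorics.SimpleGraph.LovaszThetaEdgeTransitive

/-!
# Route `AnisotropyChord`: the two-magnon sector under the automorphism group — flat vector,
# contact indicator, edge-transitive rank-one structure, vertex-transitive condensate formula
# (toolkit for the two-magnon rung TM-VT on edge-transitive graphs, `…TwoMagnonEdgeTransitive`)

Spin ½, `H(Δ) = xxzHamiltonian 1 G (−1) Δ`, two-magnon sector `K = {S^z_tot = |V|/2 − 2}`.  The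
theory seat's dictionary (`hubbard-h0-rotor-theory-1`, cycle 4, §22): `H(Δ)|_K = ½L_X + σ·ê + const`,
`σ = 1 − Δ`; here `L = H(1) + |E|/4` with kernel vector the FLAT vector `φ = 1_{weight 2}` and `ê`
the multiplication by the contact indicator `t = 1_{adjacent pair}`.  `φ` and `t` are passed as
hypothesis-characterised vectors (`hφ`; `ht2`/`ht0`, existence `exists_adjInd`); no definition is
introduced.  Content: `pair_comp_equiv`; `φ ∈ K`, `φ ∘ π̃ = φ`, `⟨φ,f⟩ = Σ_σ f(σ)`,
`H(1)φ = −(|E|/4)φ` (`xxzOne_mulVec_flat`: every transposition fixes `φ`, so each bond gives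
`𝐒_x·𝐒_yφ = ¼φ`); `t ∈ K`, `t ∘ π̃ = t` for automorphisms, `⟨t,f⟩ = Σ_{e∈E} f(e)`; on a `k`-regular graph
`(H(0) − H(1))f = (|E|/4 − k)f + t·f` on `K` (`isingDiag_mulVec_of_regular`); on an EDGE-TRANSITIVE
graph `|E|·(t·f) = ⟨t,f⟩·t` for automorphism-invariant `f` (`card_smul_adjInd_mul_eq`: `ê` is rank one
on the invariant block).  The vertex-transitive condensate formula and the assembly are in
`…TwoMagnonEdgeTransitive`.  H. Tasaki, *Physics and Mathematics of Quantum Many-Body Systems*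
(2020) §2.2, §2.4, App. A.3.
-/

set_option linter.dupNamespace false

noncomputable section

namespace Summit.HubbardSuperconductivity.HubbardSuperconductivity.Theorems.AnisotropyChord.TwoMagnon

open Matrix Complex Finset
open Literature.MathematicalPhysics.QuantumLattice
open Literature.Combinatorics.SimpleGraph (IsVertexTransitive)
open Literature.Combinatorics.SimpleGraph.LovaszThetaEdgeTransitive (IsEdgeTransitive)
open Summit.HubbardSuperconductivity.HubbardSuperconductivity.Theorems.AnisotropyChord.OneMagnon

variable {V : Type*} [Fintype V] [DecidableEq V]

/-! ### Relabelling pair configurations -/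

omit [Fintype V] in
/-- `e_a ∘ π = e_{π⁻¹ a}`. [folklore] -/
theorem single_comp_equiv (π : V ≃ V) (a : V) :
    ((Pi.single a (1 : Fin 2) : V → Fin 2) ∘ π) = Pi.single (π.symm a) 1 := by
  funext z
  simp only [Function.comp_apply, Pi.single_apply, Equiv.eq_symm_apply]

omit [Fintype V] in
/-- `(e_i + e_j) ∘ π = e_{π⁻¹ i} + e_{π⁻¹ j}`. [folklore] -/
theorem pair_comp_equiv (π : V ≃ V) (i j : V) :
    ((Pi.single i (1 : Fin 2) + Pi.single j 1 : V → Fin 2) ∘ π) =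
      Pi.single (π.symm i) 1 + Pi.single (π.symm j) 1 := by
  rw [← single_comp_equiv π i, ← single_comp_equiv π j]
  rfl

omit [Fintype V] [DecidableEq V] in
/-- The inverse of a graph automorphism preserves adjacency. [folklore] -/
theorem adj_symm_iff_of_iso {G : SimpleGraph V} (φ : G ≃g G) (x y : V) :
    G.Adj (φ.toEquiv.symm x) (φ.toEquiv.symm y) ↔ G.Adj x y := by
  have h := φ.map_rel_iff' (a := φ.toEquiv.symm x) (b := φ.toEquiv.symm y)
  rw [Equiv.apply_symm_apply, Equiv.apply_symm_apply] at h
  exact h.symm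

/-! ### The flat vector `φ = 1_{weight 2}` -/

/-- The flat vector lies in the two-magnon sector. [folklore] -/
theorem flat_mem_twoMagnonSector {φ : (V → Fin 2) → ℂ}
    (hφ : ∀ σ, φ σ = if (∑ z, (σ z : ℕ)) = 2 then 1 else 0) :
    φ ∈ spinZSector (Λ := V) 1 ((Fintype.card V : ℝ) / 2 - 2) :=
  mem_twoMagnonSector_of_support fun σ hσ => by rw [hφ σ, if_neg hσ]

omit [DecidableEq V] in
/-- The flat vector is fixed by every relabelling of the sites. [folklore] -/
theorem flat_comp_equiv {φ : (V → Fin 2) → ℂ}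
    (hφ : ∀ σ, φ σ = if (∑ z, (σ z : ℕ)) = 2 then 1 else 0) (π : V ≃ V) (σ : V → Fin 2) :
    φ (σ ∘ π) = φ σ := by
  rw [hφ, hφ σ,
    Summit.HubbardSuperconductivity.HubbardSuperconductivity.Theorems.LevyLogBootstrap.weight_comp_equiv π σ]

/-- Pairing with the flat vector is the plain sum over the sector:
`⟨φ, f⟩ = Σ_σ f(σ)` for `f` supported on weight-`2` configurations. [folklore] -/
theorem star_flat_dotProduct {φ : (V → Fin 2) → ℂ}
    (hφ : ∀ σ, φ σ = if (∑ z, (σ z : ℕ)) = 2 then 1 else 0) {f : (V → Fin 2) → ℂ}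
    (hf : ∀ σ : V → Fin 2, (∑ z, (σ z : ℕ)) ≠ 2 → f σ = 0) :
    star φ ⬝ᵥ f = ∑ σ, f σ := by
  rw [dotProduct]
  refine Finset.sum_congr rfl fun σ _ => ?_
  rw [Pi.star_apply, hφ σ]
  split_ifs with h
  · simp
  · rw [hf σ h]; simp

/-- **The flat vector is the ferromagnetic ground vector of the sector**:
`H(1) φ = −(|E|/4) φ` — every transposition fixes `φ`, so each bond gives `𝐒_x·𝐒_y φ = ¼ φ`
(`spinDot_one_mulVec_of_comp_swap`). Tasaki (2020) §2.4. [folklore] -/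
theorem xxzOne_mulVec_flat (G : SimpleGraph V) [DecidableRel G.Adj] {φ : (V → Fin 2) → ℂ}
    (hφ : ∀ σ, φ σ = if (∑ z, (σ z : ℕ)) = 2 then 1 else 0) :
    (xxzHamiltonian 1 G (-1) 1 : Op V 2) *ᵥ φ = (-((G.edgeFinset.card : ℂ) / 4)) • φ := by
  rw [xxz_at_one_eq_neg_heisenberg, heisenbergHamiltonian, Complex.ofReal_one, one_smul,
    Matrix.neg_mulVec, Matrix.sum_mulVec]
  have hterm : ∀ e ∈ G.edgeFinset, (spinDotSym 1 e : Op V 2) *ᵥ φ = (1 / 4 : ℂ) • φ := by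
    intro e he
    induction e using Sym2.ind with
    | h x y =>
      rw [SimpleGraph.mem_edgeFinset, SimpleGraph.mem_edgeSet] at he
      rw [spinDotSym_mk]
      exact spinDot_one_mulVec_of_comp_swap he.ne fun σ => flat_comp_equiv hφ _ σ
  rw [Finset.sum_congr rfl hterm, Finset.sum_const, ← Nat.cast_smul_eq_nsmul ℂ, smul_smul,
    ← neg_smul]
  congr 1
  ring

/-! ### The contact indicator `t = 1_{adjacent pair}` -/

section AdjInd

variable (G : SimpleGraph V) [DecidableRel G.Adj]

/-- **Existence of the contact indicator**: a vector `t` on configurations with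
`t(e_a + e_b) = [a ∼ b]` and `t = 0` off the weight-`2` configurations (namely
`t(σ) = Σ_{{x,y} ∈ E} [σ = e_x + e_y]`). [folklore] -/
theorem exists_adjInd :
    ∃ t : (V → Fin 2) → ℂ,
      (∀ a b : V, a ≠ b → t (Pi.single a 1 + Pi.single b 1) = if G.Adj a b then 1 else 0) ∧
      (∀ σ : V → Fin 2, (∑ z, (σ z : ℕ)) ≠ 2 → t σ = 0) := by
  refine ⟨fun σ => ∑ e ∈ G.edgeFinset, Sym2.lift ⟨fun x y =>
      if σ = Pi.single x 1 + Pi.single y 1 then (1 : ℂ) else 0,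
      fun x y => by simp only [pair_comm x y]⟩ e, ?_, ?_⟩
  · intro a b hab
    have h : ∀ e ∈ G.edgeFinset, Sym2.lift ⟨fun x y =>
        if (Pi.single a (1 : Fin 2) + Pi.single b 1 : V → Fin 2) = Pi.single x 1 + Pi.single y 1
          then (1 : ℂ) else 0, fun x y => by simp only [pair_comm x y]⟩ e =
        if e = s(a, b) then 1 else 0 := by
      intro e he
      induction e using Sym2.ind with
      | h x y =>
        rw [SimpleGraph.mem_edgeFinset, SimpleGraph.mem_edgeSet] at he
        rw [Sym2.lift_mk]
        show (if (Pi.single a (1 : Fin 2) + Pi.single b 1 : V → Fin 2) = Pi.single x 1 + Pi.single y 1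
          then (1 : ℂ) else 0) = if s(x, y) = s(a, b) then 1 else 0
        by_cases hc : (Pi.single a (1 : Fin 2) + Pi.single b 1 : V → Fin 2) = Pi.single x 1 + Pi.single y 1
        · rw [if_pos hc, if_pos]
          rcases (pair_eq_pair_iff hab he.ne).1 hc with ⟨h1, h2⟩ | ⟨h1, h2⟩
          · exact Sym2.eq_iff.2 (Or.inl ⟨h1.symm, h2.symm⟩)
          · exact Sym2.eq_iff.2 (Or.inr ⟨h2.symm, h1.symm⟩)
        · rw [if_neg hc, if_neg]
          intro hs
          apply hc
          rcases Sym2.eq_iff.1 hs with ⟨h1, h2⟩ | ⟨h1, h2⟩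
          · rw [h1, h2]
          · rw [h1, h2, pair_comm]
    show (∑ e ∈ G.edgeFinset, _) = _
    rw [Finset.sum_congr rfl h, Finset.sum_ite_eq']
    exact if_congr (by rw [SimpleGraph.mem_edgeFinset, SimpleGraph.mem_edgeSet]) rfl rfl
  · intro σ hσ
    refine Finset.sum_eq_zero fun e he => ?_
    induction e using Sym2.ind with
    | h x y =>
      rw [SimpleGraph.mem_edgeFinset, SimpleGraph.mem_edgeSet] at he
      rw [Sym2.lift_mk]
      show (if σ = Pi.single x 1 + Pi.single y 1 then (1 : ℂ) else 0) = 0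
      rw [if_neg]
      intro h
      apply hσ
      rw [h]
      exact weight_pair he.ne

variable {G}

/-- The contact indicator lies in the two-magnon sector. [folklore] -/
theorem adjInd_mem_twoMagnonSector {t : (V → Fin 2) → ℂ}
    (ht0 : ∀ σ : V → Fin 2, (∑ z, (σ z : ℕ)) ≠ 2 → t σ = 0) :
    t ∈ spinZSector (Λ := V) 1 ((Fintype.card V : ℝ) / 2 - 2) :=
  mem_twoMagnonSector_of_support ht0

/-- The contact indicator is real: `star (t σ) = t σ`. [folklore] -/
theorem star_adjInd_apply {t : (V → Fin 2) → ℂ}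
    (ht2 : ∀ a b : V, a ≠ b → t (Pi.single a 1 + Pi.single b 1) = if G.Adj a b then 1 else 0)
    (ht0 : ∀ σ : V → Fin 2, (∑ z, (σ z : ℕ)) ≠ 2 → t σ = 0) (σ : V → Fin 2) :
    star (t σ) = t σ := by
  by_cases hσ : (∑ z, (σ z : ℕ)) = 2
  · obtain ⟨i, j, hij, rfl⟩ := eq_pair_of_weight_eq_two hσ
    rw [ht2 i j hij]
    split_ifs <;> simp
  · rw [ht0 σ hσ, star_zero]

/-- Pairing with the contact indicator is the sum over the edges:
`⟨t, f⟩ = Σ_{{x,y} ∈ E} f(e_x + e_y)` for `f` supported on weight-`2` configurations. [folklore] -/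
theorem star_adjInd_dotProduct {t : (V → Fin 2) → ℂ}
    (ht2 : ∀ a b : V, a ≠ b → t (Pi.single a 1 + Pi.single b 1) = if G.Adj a b then 1 else 0)
    (ht0 : ∀ σ : V → Fin 2, (∑ z, (σ z : ℕ)) ≠ 2 → t σ = 0) {f : (V → Fin 2) → ℂ}
    (hf : ∀ σ : V → Fin 2, (∑ z, (σ z : ℕ)) ≠ 2 → f σ = 0) :
    star t ⬝ᵥ f = ∑ e ∈ G.edgeFinset, Sym2.lift ⟨fun x y => f (Pi.single x 1 + Pi.single y 1),
      fun x y => by simp only [pair_comm x y]⟩ e := by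
  have h1 : star t ⬝ᵥ f = ∑ σ, t σ * f σ := by
    rw [dotProduct]
    exact Finset.sum_congr rfl fun σ _ => by rw [Pi.star_apply, star_adjInd_apply ht2 ht0]
  -- double counting: `2 Σ_σ t f = Σ_{i ≠ j} t(e_i+e_j) f(e_i+e_j) = Σ_{i,j} [i ∼ j] f(e_i+e_j)`
  have h2 := two_smul_sum_eq_sum_pairs (fun σ => t σ * f σ)
    (fun σ hσ => by simp only [hf σ hσ, mul_zero])
  have h3 : ∑ i, ∑ j, (if i = j then 0 else
      t (Pi.single i 1 + Pi.single j 1) * f (Pi.single i 1 + Pi.single j 1)) =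
      ∑ i, ∑ j, (if G.Adj i j then f (Pi.single i 1 + Pi.single j 1) else 0) := by
    refine Finset.sum_congr rfl fun i _ => Finset.sum_congr rfl fun j _ => ?_
    by_cases hij : i = j
    · subst hij; simp
    · rw [if_neg hij, ht2 i j hij]
      split_ifs <;> simp
  rw [h3, sum_sum_ite_adj_eq_sum_edgeFinset] at h2
  have h4 : ∑ e ∈ G.edgeFinset, Sym2.lift ⟨fun x y => f (Pi.single x 1 + Pi.single y 1) +
      f (Pi.single y 1 + Pi.single x 1), fun _ _ => add_comm _ _⟩ e =
      2 • ∑ e ∈ G.edgeFinset, Sym2.lift ⟨fun x y => f (Pi.single x 1 + Pi.single y 1),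
        fun x y => by simp only [pair_comm x y]⟩ e := by
    rw [Finset.smul_sum]
    refine Finset.sum_congr rfl fun e _ => ?_
    induction e using Sym2.ind with
    | h x y =>
      rw [Sym2.lift_mk, Sym2.lift_mk]
      show f (Pi.single x 1 + Pi.single y 1) + f (Pi.single y 1 + Pi.single x 1) =
        2 • f (Pi.single x 1 + Pi.single y 1)
      rw [pair_comm y x, two_smul]
  rw [h4] at h2
  rw [h1]
  have h5 : (2 : ℂ) * (∑ σ, t σ * f σ) = 2 * ∑ e ∈ G.edgeFinset, Sym2.lift ⟨fun x y =>
      f (Pi.single x 1 + Pi.single y 1), fun x y => by simp only [pair_comm x y]⟩ e := by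
    simpa only [nsmul_eq_mul, Nat.cast_ofNat] using h2
  exact mul_left_cancel₀ two_ne_zero h5

/-- The contact indicator is fixed by the relabelling along every graph automorphism. [folklore] -/
theorem adjInd_comp_equiv {t : (V → Fin 2) → ℂ}
    (ht2 : ∀ a b : V, a ≠ b → t (Pi.single a 1 + Pi.single b 1) = if G.Adj a b then 1 else 0)
    (ht0 : ∀ σ : V → Fin 2, (∑ z, (σ z : ℕ)) ≠ 2 → t σ = 0)
    (π : V ≃ V) (hπ : ∀ x y, G.Adj (π x) (π y) ↔ G.Adj x y) (σ : V → Fin 2) :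
    t (σ ∘ π) = t σ := by
  by_cases hσ : (∑ z, (σ z : ℕ)) = 2
  · obtain ⟨i, j, hij, rfl⟩ := eq_pair_of_weight_eq_two hσ
    rw [pair_comp_equiv, ht2 _ _ (fun h => hij (π.symm.injective h)), ht2 i j hij]
    have hadj : G.Adj (π.symm i) (π.symm j) ↔ G.Adj i j := by
      have h := hπ (π.symm i) (π.symm j)
      rw [Equiv.apply_symm_apply, Equiv.apply_symm_apply] at h
      exact h.symm
    rw [if_congr hadj rfl rfl]
  · rw [ht0 σ hσ, ht0]
    rwa [Summit.HubbardSuperconductivity.HubbardSuperconductivity.Theorems.LevyLogBootstrap.weight_comp_equiv π σ]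

/-! ### The Ising part on the two-magnon sector of a regular graph -/

/-- **The Ising part on the two-magnon sector of a `k`-regular graph**:
`(H(0) − H(1)) f = (|E|/4 − k) f + t·f` for `f` supported on weight-`2` configurations
(`Z(e_i+e_j) = |E|/4 − (d_i+d_j)/2 + [i∼j]`, `isingWeight_pair`). [folklore] -/
theorem isingDiag_mulVec_of_regular {k : ℕ} (hreg : G.IsRegularOfDegree k) {t : (V → Fin 2) → ℂ}
    (ht2 : ∀ a b : V, a ≠ b → t (Pi.single a 1 + Pi.single b 1) = if G.Adj a b then 1 else 0)
    {f : (V → Fin 2) → ℂ} (hf : ∀ σ : V → Fin 2, (∑ z, (σ z : ℕ)) ≠ 2 → f σ = 0) :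
    (xxzHamiltonian 1 G (-1) 0 - xxzHamiltonian 1 G (-1) 1 : Op V 2) *ᵥ f =
      ((((G.edgeFinset.card : ℝ) / 4 - k : ℝ)) : ℂ) • f + fun σ => t σ * f σ := by
  have hD : (xxzHamiltonian 1 G (-1) 0 - xxzHamiltonian 1 G (-1) 1 : Op V 2) =
      diagonal fun σ => (((∑ e ∈ G.edgeFinset, Sym2.lift ⟨fun x y =>
        ((1 : ℝ) / 2 - (σ x : ℕ)) * ((1 : ℝ) / 2 - (σ y : ℕ)), fun _ _ => mul_comm _ _⟩ e : ℝ)) : ℂ) := by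
    rw [xxz_eq_neg_heisenberg_add_diagonal, xxz_eq_neg_heisenberg_add_diagonal]
    ext σ τ
    simp only [Matrix.sub_apply, Matrix.add_apply, Matrix.neg_apply, diagonal_apply]
    split_ifs
    · push_cast; ring
    · ring
  rw [hD]
  funext σ
  rw [mulVec_diagonal, Pi.add_apply, Pi.smul_apply, smul_eq_mul]
  by_cases hσ : (∑ z, (σ z : ℕ)) = 2
  · obtain ⟨i, j, hij, rfl⟩ := eq_pair_of_weight_eq_two hσ
    rw [isingWeight_pair G hij _ rfl, hreg.degree_eq i, hreg.degree_eq j, ht2 i j hij]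
    split_ifs <;> push_cast <;> ring
  · rw [hf σ hσ]
    simp

/-! ### Edge-transitivity: the contact operator is rank one on the invariant block -/

omit [Fintype V] [DecidableRel G.Adj] in
/-- On an EDGE-TRANSITIVE graph a vector fixed by all graph automorphisms is constant on the
adjacent pair configurations. [folklore] -/
theorem apply_pair_eq_of_edgeTransitive (hET : IsEdgeTransitive G) {f : (V → Fin 2) → ℂ}
    (hfix : ∀ π : V ≃ V, (∀ x y, G.Adj (π x) (π y) ↔ G.Adj x y) → ∀ σ, f (σ ∘ π) = f σ)
    {a b c d : V} (hab : G.Adj a b) (hcd : G.Adj c d) :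
    f (Pi.single a 1 + Pi.single b 1) = f (Pi.single c 1 + Pi.single d 1) := by
  obtain ⟨φ, h⟩ := hET hab hcd
  have key : (Pi.single c (1 : Fin 2) + Pi.single d 1 : V → Fin 2) =
      (Pi.single a 1 + Pi.single b 1 : V → Fin 2) ∘ φ.toEquiv.symm := by
    rw [pair_comp_equiv, Equiv.symm_symm]
    rcases h with ⟨h1, h2⟩ | ⟨h1, h2⟩
    · rw [← h1, ← h2]; rfl
    · rw [← h1, ← h2, pair_comm]; rfl
  rw [key, hfix φ.toEquiv.symm (adj_symm_iff_of_iso φ)]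

/-- **The contact operator is rank one on the invariant block of an edge-transitive graph**:
`|E|·(t·f) = ⟨t, f⟩·t` for every `f` of the two-magnon sector fixed by all graph automorphisms.
[folklore] -/
theorem card_smul_adjInd_mul_eq (hET : IsEdgeTransitive G) {t : (V → Fin 2) → ℂ}
    (ht2 : ∀ a b : V, a ≠ b → t (Pi.single a 1 + Pi.single b 1) = if G.Adj a b then 1 else 0)
    (ht0 : ∀ σ : V → Fin 2, (∑ z, (σ z : ℕ)) ≠ 2 → t σ = 0) {f : (V → Fin 2) → ℂ}
    (hf : ∀ σ : V → Fin 2, (∑ z, (σ z : ℕ)) ≠ 2 → f σ = 0)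
    (hfix : ∀ π : V ≃ V, (∀ x y, G.Adj (π x) (π y) ↔ G.Adj x y) → ∀ σ, f (σ ∘ π) = f σ) :
    (G.edgeFinset.card : ℂ) • (fun σ => t σ * f σ) = (star t ⬝ᵥ f) • t := by
  rw [star_adjInd_dotProduct ht2 ht0 hf]
  by_cases hE : G.edgeFinset = ∅
  · -- no edge: `t = 0`
    have ht : ∀ σ, t σ = 0 := by
      intro σ
      by_cases hσ : (∑ z, (σ z : ℕ)) = 2
      · obtain ⟨i, j, hij, rfl⟩ := eq_pair_of_weight_eq_two hσ
        rw [ht2 i j hij, if_neg]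
        intro hadj
        have : s(i, j) ∈ G.edgeFinset := by
          rw [SimpleGraph.mem_edgeFinset, SimpleGraph.mem_edgeSet]; exact hadj
        rw [hE] at this
        exact Finset.notMem_empty _ this
      · exact ht0 σ hσ
    funext σ
    simp [ht σ]
  obtain ⟨e₀, he₀⟩ := Finset.nonempty_iff_ne_empty.2 hE
  induction e₀ using Sym2.ind with
  | h a b =>
    rw [SimpleGraph.mem_edgeFinset, SimpleGraph.mem_edgeSet] at he₀
    set fE : ℂ := f (Pi.single a 1 + Pi.single b 1) with hfEdef
    have hconst : ∀ e ∈ G.edgeFinset, Sym2.lift ⟨fun x y => f (Pi.single x 1 + Pi.single y 1),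
        fun x y => by simp only [pair_comm x y]⟩ e = fE := by
      intro e he
      induction e using Sym2.ind with
      | h x y =>
        rw [SimpleGraph.mem_edgeFinset, SimpleGraph.mem_edgeSet] at he
        rw [Sym2.lift_mk]
        exact apply_pair_eq_of_edgeTransitive hET hfix he he₀
    rw [Finset.sum_congr rfl hconst, Finset.sum_const, nsmul_eq_mul]
    have hpt : ∀ σ, t σ * f σ = fE * t σ := by
      intro σ
      by_cases hσ : (∑ z, (σ z : ℕ)) = 2
      · obtain ⟨i, j, hij, rfl⟩ := eq_pair_of_weight_eq_two hσ
        rw [ht2 i j hij]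
        split_ifs with hadj
        · rw [one_mul, mul_one]
          exact apply_pair_eq_of_edgeTransitive hET hfix hadj he₀
        · rw [zero_mul, mul_zero]
      · rw [ht0 σ hσ, zero_mul, mul_zero]
    funext σ
    rw [Pi.smul_apply, Pi.smul_apply, smul_eq_mul, smul_eq_mul, hpt σ]
    ring

end AdjInd

end Summit.HubbardSuperconductivity.HubbardSuperconductivity.Theorems.AnisotropyChord.TwoMagnon
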